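import Summits.BirchSwinnertonDyer.BirchSwinnertonDyer.Theorems.ManinLocalTwoThreeTowerOnePrime

/-!
# E-an-135♭ — the ∃q-FORM of the tower unit-twist law suffices: E-es-66 / E-es-66₂ ⟸ `SomeTowerUnitTwist p`, and
# E-an-135 ⟹ E-an-135♭ (Dirichlet)  (an g30, MEMO-an §72.0 / §72.5, HOME/an/g30/Sketch-an-g30.lean §1; ask «p2 (i)»)

Summit `BirchSwinnertonDyer`, route `ManinLocalTwoThree` (cell bsd-f2-manin, analytic lens), cruxes C3 `ManinPrimeToThreeAtNine`
(stmt-BirchSwinnertonDyer-22968, input `h66`) / C2 `ManinOddAtFour` (stmt-…-22967, input `h66₂`).  The reductions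
`KatoCurve.threeAdicWitness_of_towerUnitTwist` (typer) / `…Theorems…TowerReduction` (this seat) consume the tree law E-an-135
`KatoCurve.TowerUnitTwist p` (ALL admissible primes `q`) but use ONE `q`; an g30 types the weaker ∃q-form **E-an-135♭
`BsdF2ManinAnG30.SomeTowerUnitTwist p`** (arbitrarily large admissible `q` carrying the tower unit twist), which §72 proves on the generic
Chebotarev cell.  This file (by value — the g30 `def`s are not yet in the tree — with the tree's `KatoCurve.UnitTwistAt` BY NAME):

* `threeAdicPolarWitness_of_unitTwistAt_tower`, `twoAdicPolarWitness_of_unitTwistAt_tower` — the bare assembly: ONE primitive even `χ` of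
  conductor `qⁿ` beyond the Wieferich level of `9` (resp. `8`) with `UnitTwistAt p W D.f χ` gives the polar witness of E-es-66 (resp. 66₂)
  at the datum `D` (modularity-free, `KatoCurve.additive_of_sq_dvd_level`).
* `threeAdicWitness_of_someTowerUnitTwist : SomeTowerUnitTwist 3 (by value) → ThreeAdicWitnessOfPlusIndexPrimeToThree`,
  `twoAdicWitness_of_someTowerUnitTwist : SomeTowerUnitTwist 2 (by value) → TwoAdicWitnessOfPlusIndexOdd` — E-an-136 from the ∃q-form.
* `someTowerUnitTwist_of_towerUnitTwist` — the edge `TowerImpliesSome` (by value): `p.Prime → TowerUnitTwist p → SomeTowerUnitTwist p`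
  (Dirichlet primes `q ≡ −1 (mod 4p)` beyond any bound).

HONEST FRAMING: bookkeeping; E-an-135/135♭ remain LAWS.  C2/C3, Manin's conjecture and BSD are NOT proved by this.  No definitions.
-/

set_option linter.dupNamespace false
set_option autoImplicit false

noncomputable section

open scoped Classical MatrixGroups ModularForm ComplexConjugate

open CongruenceSubgroup Complex WeierstrassCurve Literature.NumberTheory.EllipticCurves
  Literature.NumberTheory.EllipticCurves.ModularForms
  Summit.BirchSwinnertonDyer.Rank1Residual.ManinAdditive.KatoCurve

namespace Summit.BirchSwinnertonDyer.BirchSwinnertonDyer.Theorems.ManinLocalTwoThree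

variable (W : WeierstrassCurve ℚ) [W.IsElliptic] {N : ℕ} [NeZero N] (D : ModularParametrizationData W N)

/-! ### §1 The bare assembly: ONE tower unit twist beyond the Wieferich level gives the polar witness -/

/-- **E-es-66's witness at `D` from ONE tower unit twist**: `9 ∣ N`, `q` an odd prime `≠ 3` with `q ∤ N`, `3 ∤ (q-1)/2`, a level
`n > v_q(9^{q-1} - 1)` and a PRIMITIVE EVEN `χ` mod `qⁿ` with `UnitTwistAt 3 W D.f χ` ⟹ `ThreeAdicPolarWitness W W D.f` (modularity-free). -/
theorem threeAdicPolarWitness_of_unitTwistAt_tower (h9 : 3 ^ 2 ∣ N)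
    {q : ℕ} [Fact q.Prime] (hq2 : q ≠ 2) (hq3 : q ≠ 3) (hqN : ¬ q ∣ N) (h3q : ¬ 3 ∣ (q - 1) / 2)
    {n : ℕ} (hn : padicValNat q (9 ^ (q - 1) - 1) < n)
    {χ : DirichletCharacter ℂ (q ^ n)} (hprim : χ.IsPrimitive) (heven : χ.Even) (hU : UnitTwistAt 3 W D.f χ) :
    ThreeAdicPolarWitness W W D.f := by
  have hq : q.Prime := Fact.out
  have hqodd : q % 2 = 1 := hq.eq_two_or_odd.resolve_left hq2
  obtain ⟨r, hr, hunit⟩ := hU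
  haveI : NeZero (q ^ n) := ⟨pow_ne_zero _ hq.ne_zero⟩
  have hn1 : 1 ≤ n := by omega
  have hq9 : ¬ q ∣ 9 := fun h =>
    hq3 ((Nat.prime_dvd_prime_iff_eq hq Nat.prime_three).mp (hq.dvd_of_dvd_pow (show q ∣ 3 ^ 2 from h)))
  have h9χ : χ ((9 : ℕ) : ZMod (q ^ n)) ≠ 1 := wieferichLevel q 9 n hq hq2 (by norm_num) hq9 hn χ hprim
  have hχ3sq : χ (3 : ZMod (q ^ n)) ^ 2 ≠ 1 := by
    rw [← map_pow]
    convert h9χ using 2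
    push_cast
    norm_num
  have hχ3 : χ (3 : ZMod (q ^ n)) ≠ 1 := fun h => hχ3sq (by rw [h, one_pow])
  have hχ3' : χ (3 : ZMod (q ^ n)) ≠ -1 := fun h => hχ3sq (by rw [h, neg_one_sq])
  have hχne : χ ≠ 1 := by
    rintro rfl
    rw [DirichletCharacter.isPrimitive_def, DirichletCharacter.conductor_one] at hprim
    have : 1 < q ^ n := Nat.one_lt_pow (by omega) hq.one_lt
    omega
  have hordχ : orderOf χ ∣ q ^ (n - 1) * (q - 1) := by
    have h := orderOf_dirichletCharacter_dvd_totient χ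
    rwa [Nat.totient_prime_pow hq hn1] at h
  have h3ord : ¬ 3 ∣ orderOf χ := by
    intro h3
    rcases (Nat.Prime.dvd_mul Nat.prime_three).mp (h3.trans hordχ) with h | h
    · exact hq3 ((Nat.prime_dvd_prime_iff_eq Nat.prime_three hq).mp
        (Nat.prime_three.dvd_of_dvd_pow h)).symm
    · omega
  have hcop : (q ^ n).Coprime (3 * N) := by
    apply Nat.Coprime.pow_left
    rw [Nat.coprime_mul_iff_right]
    exact ⟨(Nat.coprime_primes hq Nat.prime_three).mpr hq3, (hq.coprime_iff_not_dvd).mpr hqN⟩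
  haveI : Fact (Nat.Prime 3) := ⟨Nat.prime_three⟩
  have hadd := additive_of_sq_dvd_level 3 W D.f D.isNewformOf h9
  refine ⟨q ^ n, inferInstance, χ, r, 1, D.isNewformOf, hadd.1, hadd.2, hcop, hprim, hχne, h3ord,
    hχ3, hχ3', heven, by simp, hr, fun s hs => ?_⟩
  simpa using hunit s hs

/-- **E-es-66₂'s witness at `D` from ONE tower unit twist**: `4 ∣ N`, `q` a prime with `2 ∤ (q-1)/2`, `q ∤ N`, a level
`n > v_q(8^{q-1} - 1)` and a PRIMITIVE EVEN `χ` mod `qⁿ` with `UnitTwistAt 2 W D.f χ` ⟹ `TwoAdicPolarWitness W W D.f`. -/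
theorem twoAdicPolarWitness_of_unitTwistAt_tower (h4 : 2 ^ 2 ∣ N)
    {q : ℕ} [Fact q.Prime] (hq2 : q ≠ 2) (hqN : ¬ q ∣ N) (h2q : ¬ 2 ∣ (q - 1) / 2)
    {n : ℕ} (hn : padicValNat q (8 ^ (q - 1) - 1) < n)
    {χ : DirichletCharacter ℂ (q ^ n)} (hprim : χ.IsPrimitive) (heven : χ.Even) (hU : UnitTwistAt 2 W D.f χ) :
    TwoAdicPolarWitness W W D.f := by
  have hq : q.Prime := Fact.out
  have hq3 : 3 ≤ q := by
    rcases hq.eq_two_or_odd' with h | h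
    · exact absurd h hq2
    · have := hq.two_le; rcases h with ⟨k, hk⟩; omega
  obtain ⟨r, hr, hunit⟩ := hU
  haveI : NeZero (q ^ n) := ⟨pow_ne_zero _ hq.ne_zero⟩
  have hn1 : 1 ≤ n := by omega
  have hq8 : ¬ q ∣ 8 := fun h =>
    hq2 ((Nat.prime_dvd_prime_iff_eq hq Nat.prime_two).mp (hq.dvd_of_dvd_pow (show q ∣ 2 ^ 3 from h)))
  have h8χ : χ ((8 : ℕ) : ZMod (q ^ n)) ≠ 1 := wieferichLevel q 8 n hq hq2 (by norm_num) hq8 hn χ hprim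
  have hχ8 : χ (8 : ZMod (q ^ n)) ≠ 1 := by
    convert h8χ using 2
    push_cast
    rfl
  have hχne : χ ≠ 1 := by
    rintro rfl
    rw [DirichletCharacter.isPrimitive_def, DirichletCharacter.conductor_one] at hprim
    have : 1 < q ^ n := Nat.one_lt_pow (by omega) hq.one_lt
    omega
  have h2ord : ¬ 2 ∣ orderOf χ := by
    intro h2
    have hM := orderOf_dvd_of_pow_eq_one (pow_half_totient_eq_one_of_even hq hq2 hn1 heven)
    rcases (Nat.Prime.dvd_mul Nat.prime_two).mp (h2.trans hM) with h | h
    · exact hq2 ((Nat.prime_dvd_prime_iff_eq Nat.prime_two hq).mp (Nat.prime_two.dvd_of_dvd_pow h)).symm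
    · exact h2q h
  have hcop : (q ^ n).Coprime (2 * N) := by
    apply Nat.Coprime.pow_left
    rw [Nat.coprime_mul_iff_right]
    exact ⟨(Nat.coprime_primes hq Nat.prime_two).mpr hq2, (hq.coprime_iff_not_dvd).mpr hqN⟩
  haveI : Fact (Nat.Prime 2) := ⟨Nat.prime_two⟩
  have hadd := additive_of_sq_dvd_level 2 W D.f D.isNewformOf h4
  refine ⟨q ^ n, inferInstance, χ, r, 1, D.isNewformOf, hadd.1, hadd.2, hcop, hprim, hχne, h2ord,
    hχ8, by simp, hr, fun s hs => ?_⟩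
  simpa using hunit s hs

/-! ### §2 E-an-136 from the ∃q-form E-an-135♭ (Sketch-an-g30 §1, by value) -/

/-- **E-es-66 ⟸ E-an-135♭(3)** (`SomeTowerUnitTwist 3` by value ⟹ `ThreeAdicWitnessOfPlusIndexPrimeToThree`), modularity-free. -/
theorem threeAdicWitness_of_someTowerUnitTwist
    (h : ∀ (W : WeierstrassCurve ℚ) [W.IsElliptic] {N : ℕ} [NeZero N] (f : CuspForm (Gamma0 N) 2),
      IsNewformOf W f → PlusIndexPrimeTo 3 f →
      ∀ N₀ : ℕ, ∃ (q : ℕ) (_ : Fact q.Prime), N₀ < q ∧ q ≠ 2 ∧ q ≠ 3 ∧ ¬ q ∣ N ∧ ¬ 3 ∣ (q - 1) / 2 ∧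
        ∀ n₁ : ℕ, ∃ n : ℕ, n₁ ≤ n ∧
          ∃ χ : DirichletCharacter ℂ (q ^ n), χ.IsPrimitive ∧ χ.Even ∧ UnitTwistAt 3 W f χ) :
    ThreeAdicWitnessOfPlusIndexPrimeToThree := by
  intro W _ _ N _ D hopt h9 hplus
  obtain ⟨q, hqF, -, hq2, hq3, hqN, h3q, htower⟩ := h W D.f D.isNewformOf hplus 0
  obtain ⟨n, hn, χ, hprim, heven, hU⟩ := htower (padicValNat q (9 ^ (q - 1) - 1) + 1)
  exact threeAdicPolarWitness_of_unitTwistAt_tower W D h9 hq2 hq3 hqN h3q (Nat.lt_of_succ_le hn) hprim heven hU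

/-- **E-es-66₂ ⟸ E-an-135♭(2)** (`SomeTowerUnitTwist 2` by value ⟹ `TwoAdicWitnessOfPlusIndexOdd`), modularity-free. -/
theorem twoAdicWitness_of_someTowerUnitTwist
    (h : ∀ (W : WeierstrassCurve ℚ) [W.IsElliptic] {N : ℕ} [NeZero N] (f : CuspForm (Gamma0 N) 2),
      IsNewformOf W f → PlusIndexPrimeTo 2 f →
      ∀ N₀ : ℕ, ∃ (q : ℕ) (_ : Fact q.Prime), N₀ < q ∧ q ≠ 2 ∧ q ≠ 2 ∧ ¬ q ∣ N ∧ ¬ 2 ∣ (q - 1) / 2 ∧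
        ∀ n₁ : ℕ, ∃ n : ℕ, n₁ ≤ n ∧
          ∃ χ : DirichletCharacter ℂ (q ^ n), χ.IsPrimitive ∧ χ.Even ∧ UnitTwistAt 2 W f χ) :
    TwoAdicWitnessOfPlusIndexOdd := by
  intro W _ _ N _ D hopt h4 hplus
  obtain ⟨q, hqF, -, hq2, -, hqN, h2q, htower⟩ := h W D.f D.isNewformOf hplus 0
  obtain ⟨n, hn, χ, hprim, heven, hU⟩ := htower (padicValNat q (8 ^ (q - 1) - 1) + 1)
  exact twoAdicPolarWitness_of_unitTwistAt_tower W D h4 hq2 hqN h2q (Nat.lt_of_succ_le hn) hprim heven hU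

/-! ### §3 E-an-135 ⟹ E-an-135♭ (the edge `TowerImpliesSome`, by value: Dirichlet primes `q ≡ −1 (mod 4p)`) -/

/-- For a prime `p` and any bound there is a prime `q > N₀` with `q ≡ −1 (mod 4p)`; such `q` is odd, `≠ p`, and has
`p ∤ (q−1)/2` (`(q−1)/2 ≡ −1 (mod p)`). [folklore] -/
theorem exists_prime_gt_admissible (p : ℕ) (hp : p.Prime) (N₀ : ℕ) :
    ∃ q : ℕ, N₀ < q ∧ q.Prime ∧ q ≠ 2 ∧ q ≠ p ∧ ¬ p ∣ (q - 1) / 2 := by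
  have hp1 := hp.two_le
  have h4p : 4 * p ≠ 0 := by omega
  have hcop : (4 * p - 1).Coprime (4 * p) := by
    have h : (4 * p - 1 + 1).Coprime (4 * p - 1) ↔ (1 : ℕ).Coprime (4 * p - 1) := Nat.coprime_self_add_left
    have h' : (4 * p - 1 + 1) = 4 * p := by omega
    rw [h'] at h
    exact (h.mpr (Nat.coprime_one_left _)).symm
  obtain ⟨q, hqN, hq, hmod⟩ := Nat.forall_exists_prime_gt_and_modEq N₀ h4p hcop
  have hqmod : q % (4 * p) = 4 * p - 1 := by
    have h : q % (4 * p) = (4 * p - 1) % (4 * p) := hmod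
    rwa [Nat.mod_eq_of_lt (by omega : 4 * p - 1 < 4 * p)] at h
  have hqge : 4 * p - 1 ≤ q := hqmod ▸ Nat.mod_le q (4 * p)
  have hdvd : 4 * p ∣ q + 1 := by
    have h := Nat.div_add_mod q (4 * p)
    rw [hqmod] at h
    set X := 4 * p * (q / (4 * p)) with hX
    refine ⟨q / (4 * p) + 1, ?_⟩
    rw [mul_add, mul_one, ← hX]
    omega
  refine ⟨q, hqN, hq, by omega, by omega, fun hdiv ↦ ?_⟩
  obtain ⟨c, hc⟩ := hdvd
  set Y := p * c with hY
  have hc' : q + 1 = 4 * Y := by rw [hc, hY]; ring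
  have hY1 : 1 ≤ Y := by omega
  have hhalf : (q - 1) / 2 = 2 * Y - 1 := by omega
  rw [hhalf] at hdiv
  have h2Y : p ∣ 2 * Y := ⟨2 * c, by rw [hY]; ring⟩
  have h1 : p ∣ 2 * Y - (2 * Y - 1) := Nat.dvd_sub h2Y hdiv
  have : 2 * Y - (2 * Y - 1) = 1 := by omega
  rw [this, Nat.dvd_one] at h1
  exact hp.one_lt.ne' h1

/-- **E-an-135 ⟹ E-an-135♭** (the edge `TowerImpliesSome` of Sketch-an-g30, by value): the all-`q` law gives the ∃q-form with
admissible primes `q ≡ −1 (mod 4p)` beyond any bound. -/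
theorem someTowerUnitTwist_of_towerUnitTwist {p : ℕ} (hp : p.Prime) (hT : TowerUnitTwist p) :
    ∀ (W : WeierstrassCurve ℚ) [W.IsElliptic] {N : ℕ} [NeZero N] (f : CuspForm (Gamma0 N) 2),
      IsNewformOf W f → PlusIndexPrimeTo p f →
      ∀ N₀ : ℕ, ∃ (q : ℕ) (_ : Fact q.Prime), N₀ < q ∧ q ≠ 2 ∧ q ≠ p ∧ ¬ q ∣ N ∧ ¬ p ∣ (q - 1) / 2 ∧
        ∀ n₁ : ℕ, ∃ n : ℕ, n₁ ≤ n ∧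
          ∃ χ : DirichletCharacter ℂ (q ^ n), χ.IsPrimitive ∧ χ.Even ∧ UnitTwistAt p W f χ := by
  intro W _ N _ f hWf hd N₀
  obtain ⟨q, hqgt, hq, hq2, hqp, hpq⟩ := exists_prime_gt_admissible p hp (max N₀ N)
  haveI : Fact q.Prime := ⟨hq⟩
  have hqN : ¬ q ∣ N := fun h ↦ by
    have := Nat.le_of_dvd (Nat.pos_of_ne_zero (NeZero.ne N)) h
    omega
  exact ⟨q, inferInstance, lt_of_le_of_lt (le_max_left _ _) hqgt, hq2, hqp, hqN, hpq,
    fun n₁ ↦ hT W f hWf hd q hq2 hqp hqN hpq n₁⟩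

end Summit.BirchSwinnertonDyer.BirchSwinnertonDyer.Theorems.ManinLocalTwoThree

end
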